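import Literature.AlgebraicGeometry.HodgeTheory.ZariskiClosedStraightening
import Literature.AlgebraicGeometry.HodgeTheory.AlgebraicClasses
import Literature.AlgebraicTopology.SingularHomology.LocallyFlatComplement
import Literature.AlgebraicTopology.SingularHomology.UniversalCoefficientsField
import Literature.NumberTheory.Transcendental.AnalytificationSecondCountableProofs
import HarnessLib

/-!
# Semipurity of the coniveau filtration: `Nᶜ Hⁱ(X(ℂ); ℂ) = 0` for `i < 2c` (Grothendieck 1969; Voisin I, §11.1.2)

A. Grothendieck, *Hodge's general conjecture is false for trivial reasons*, Topology 8 (1969), §1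
(the coniveau filtration `Nᶜ Hⁱ`: "the subspace of classes vanishing on the complement of a
Zariski-closed subset of codimension `≥ c`"; that `Nᶜ Hⁱ = 0` for `i < 2c` is the semipurity half
of the purity of local cohomology for smooth varieties); C. Voisin, *Hodge Theory and Complex
Algebraic Geometry I* (2002), §11.1.2: Lemma 11.13 ("`Hˡ(X) → Hˡ(X − Y)` is an isomorphism for
`l ≤ 2r`", `Y` a closed complex submanifold of codimension `> r`) applied along the filtration
of Thm. 11.11 ("`Z_k − Z_{k+1}` is a smooth closed complex submanifold of `X − Z_{k+1}`").

For `X` smooth projective over `ℂ` and the tree's carrier `supportedClasses X i c = Nᶜ Hⁱ(X(ℂ); ℂ)`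
(`HodgeTheory/AlgebraicClasses`, the sum over Zariski-closed `Z` of codimension `≥ c` of
`ker (Hⁱ(X(ℂ); ℂ) → Hⁱ((X ∖ Z)(ℂ); ℂ))`) this file PROVES:

* `surjective_map_complexPointsCompl_of_le_coheight` — **homological semipurity**: for `Z ⊆ X`
  Zariski-closed with every point of codimension `≥ c`, the map
  `Hᵢ((X ∖ Z)(ℂ); F) → Hᵢ(X(ℂ); F)` is onto for `i < 2c` (any coefficients). Proof by downward
  induction on `c` along Voisin's filtration: `Z ⊇ Z₁` with `Z₁` closed of codimension `≥ c + 1`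
  and `Z(ℂ)` locally flat of real codimension `≥ 2c` in `X(ℂ)` off `Z₁(ℂ)`
  (`GAGADimension.exists_closed_straightening_off`, file `ZariskiClosedStraightening`: Serre's GAGA
  comparison at simple points); on the open subspace `(X ∖ Z₁)(ℂ)` the topological Lemma 11.13
  (`SingularHomology.surjective_injective_map_compl_of_locallyFlat`, file
  `SingularHomology/LocallyFlatComplement`) gives `Hᵢ((X ∖ Z)(ℂ)) ↠ Hᵢ((X ∖ Z₁)(ℂ))`, and the
  induction hypothesis `Hᵢ((X ∖ Z₁)(ℂ)) ↠ Hᵢ(X(ℂ))`.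
* `injective_restrictCompl_of_le_coheight` — dually (Kronecker pairing over the field `ℂ`,
  `kroneckerPairing_injective_of_field`, `kroneckerPairing_map`), the restriction
  `Hⁱ(X(ℂ); ℂ) → Hⁱ((X ∖ Z)(ℂ); ℂ)` is one-to-one for `i < 2c`.
* `supportedClasses_eq_bot_of_lt` — **`Nᶜ Hⁱ(X(ℂ); ℂ) = 0` for `i < 2c`**; in particular
  (`algebraicClasses_eq_bot_iff`-type consequences are left to consumers) no non-zero class of
  degree `< 2c` dies off a codimension-`c` Zariski-closed subset.

Everything is proved; no definitions, no named facts.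

## References

* [GrothendieckTopology1969] A. Grothendieck, Hodge's general conjecture is false for trivial
  reasons, Topology 8 (1969), §1.
* [VoisinHodgeI2002] C. Voisin, Hodge Theory and Complex Algebraic Geometry I, CUP 2002, §11.1.1
  Thm. 11.11, §11.1.2 Lemma 11.13.
* [HatcherAT2002] A. Hatcher, Algebraic Topology, CUP 2002, §3.1 Thm. 3.2 (universal
  coefficients over a field).
-/

noncomputable section

open CategoryTheory AlgebraicGeometry Set TopologicalSpace
open Literature.AlgebraicTopology.SingularHomology

namespace Literature.AlgebraicGeometry.HodgeTheory

section HodgeTheory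

/-! ### Duality: onto on homology gives one-to-one on cohomology over a field -/

/-- Over a field, if `f_* : Hₙ(A; F) → Hₙ(B; F)` is onto then `f^* : Hⁿ(B; F) → Hⁿ(A; F)` is
one-to-one: `⟨f^* a, c⟩ = ⟨a, f_* c⟩` (the tree's `kroneckerPairing_map`) and the Kronecker map
`Hⁿ(B; F) → Hom(Hₙ(B; F), F)` is one-to-one (`kroneckerPairing_injective_of_field`, Hatcher
Thm. 3.2). [cite: HatcherAT2002, §3.1 Thm. 3.2 (p. 195) and p. 198] -/
theorem injective_cohomologyMap_of_surjective_homologyMap (F : Type) [Field F] {A B : Type}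
    [TopologicalSpace A] [TopologicalSpace B] (f : C(A, B)) (n : ℕ)
    (hf : Function.Surjective (singularHomology.map F F f n)) :
    Function.Injective (singularCohomology.map F F f n) := by
  refine (injective_iff_map_eq_zero _).2 fun a ha ↦ kroneckerPairing_injective_of_field F B n ?_
  rw [map_zero]
  refine LinearMap.ext fun c ↦ ?_
  obtain ⟨c', rfl⟩ := hf c
  rw [← kroneckerPairing_map, ha, map_zero, LinearMap.zero_apply, LinearMap.zero_apply]

/-! ### Homological semipurity -/

variable {n : ℕ} {X : Motives.SchemeOver ℂ}

/-- A Zariski-closed subset all of whose points have codimension `> dim X` is empty (codimension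
is at most the dimension on a smooth projective variety). [folklore] -/
theorem eq_empty_of_dim_lt_coheight (hX : Motives.IsSmoothProjective n X) {Z : Set X.left} {c : ℕ}
    (hc : n + 1 ≤ c) (hZ : ∀ z ∈ Z, (c : ℕ∞) ≤ Order.coheight z) : Z = ∅ := by
  refine Set.eq_empty_of_forall_notMem fun z hz ↦ ?_
  obtain ⟨a, b, -, hb, hab⟩ := exists_height_eq_coheight_eq hX z
  have h := hZ z hz
  rw [hb] at h
  have h' : c ≤ b := by exact_mod_cast h
  omega

/-- **Homological semipurity** (Voisin I, Lemma 11.13 along the filtration of Thm. 11.11;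
Grothendieck 1969 §1): for `X` smooth projective over `ℂ`, `Z ⊆ X` Zariski-closed with every
point of codimension `≥ c`, and every `i < 2c`, the map `Hᵢ((X ∖ Z)(ℂ); M) → Hᵢ(X(ℂ); M)` induced
by the inclusion of the complex points of the complement (strong topology) is onto. Downward
induction on `c`: off a closed `Z₁ ⊆ Z` of codimension `≥ c + 1` the set `Z(ℂ)` is locally flat
of real codimension `≥ 2c` in `X(ℂ)` (`GAGADimension.exists_closed_straightening_off`), so on the
open subspace `(X ∖ Z₁)(ℂ)` the inclusion of `(X ∖ Z)(ℂ)` is onto on `Hᵢ`, `i < 2c`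
(`surjective_injective_map_compl_of_locallyFlat`); compose with the induction hypothesis for `Z₁`.
[cite: VoisinHodgeI2002, §11.1.2 Lemma 11.13 and §11.1.1 Thm. 11.11] [cite: GrothendieckTopology1969, §1] -/
theorem surjective_map_complexPointsCompl_of_le_coheight (R : Type) [CommRing R] (M : Type)
    [AddCommGroup M] [Module R M] (hX : Motives.IsSmoothProjective n X) {Z : Set X.left}
    (hZ : IsClosed Z) {c : ℕ} (hcZ : ∀ z ∈ Z, (c : ℕ∞) ≤ Order.coheight z) {i : ℕ}
    (hi : i < 2 * c) :
    Function.Surjective (singularHomology.map R M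
      (subsetIncl {P : Motives.ComplexPoints X | P.pt ∉ Z}) i) := by
  -- second countability of `X(ℂ)`
  haveI := hX.smoothOfRelativeDimension
  haveI : LocallyOfFiniteType X.hom := by
    haveI : Smooth X.hom := SmoothOfRelativeDimension.smooth n _
    infer_instance
  haveI := Motives.IsSmoothProjective.compactSpace_holds hX
  haveI : SecondCountableTopology (Motives.ComplexPoints X) :=
    Motives.ComplexPoints.secondCountableTopology_of_compactSpace_holds X
  -- downward induction on the codimension, along Voisin's filtration
  suffices key : ∀ (m c : ℕ) (Z : Set X.left), n + 1 ≤ c + m → IsClosed Z →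
      (∀ z ∈ Z, (c : ℕ∞) ≤ Order.coheight z) → ∀ i, i < 2 * c →
        Function.Surjective (singularHomology.map R M
          (subsetIncl {P : Motives.ComplexPoints X | P.pt ∉ Z}) i) from
    key (n + 1) c Z (by omega) hZ hcZ i hi
  -- the empty case
  have hempty : ∀ (Z : Set X.left), Z = ∅ → ∀ i, Function.Surjective (singularHomology.map R M
      (subsetIncl {P : Motives.ComplexPoints X | P.pt ∉ Z}) i) := by
    rintro Z rfl i
    have hc : ((Homeomorph.refl (Motives.ComplexPoints X) : _ ≃ₜ _) :
        C(Motives.ComplexPoints X, Motives.ComplexPoints X)).comp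
        (subsetIncl {P : Motives.ComplexPoints X | P.pt ∉ (∅ : Set X.left)}) =
        (ContinuousMap.id _).comp (((Homeomorph.setCongr (by ext P; simp)).trans
          (Homeomorph.Set.univ (Motives.ComplexPoints X)) :
            ↥{P : Motives.ComplexPoints X | P.pt ∉ (∅ : Set X.left)} ≃ₜ Motives.ComplexPoints X) :
          C(↥{P : Motives.ComplexPoints X | P.pt ∉ (∅ : Set X.left)}, Motives.ComplexPoints X)) :=
      ContinuousMap.ext fun _ ↦ rfl
    refine (surjective_map_iff_of_homeomorph R M _ _ _ _ hc i).2 ?_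
    rw [singularHomology.map_id]
    exact Function.surjective_id
  intro m
  induction m with
  | zero =>
    intro c Z hcm hZ hcZ i hi
    exact hempty Z (eq_empty_of_dim_lt_coheight hX (by omega) hcZ) i
  | succ m ih =>
    intro c Z hcm hZ hcZ i hi
    by_cases hcn : n + 1 ≤ c
    · exact hempty Z (eq_empty_of_dim_lt_coheight hX hcn hcZ) i
    -- the exceptional set `Z₁` and the straightening charts off it
    obtain ⟨Z₁, hZ₁, hZ₁Z, hcZ₁, hstr⟩ := GAGADimension.exists_closed_straightening_off hX hZ hcZ
    have ih₁ := ih (c + 1) Z₁ (by omega) hZ₁ hcZ₁ i (by omega)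
    -- the open subspace `X₁ = (X ∖ Z₁)(ℂ)` and its closed subset `S = Z(ℂ) ∩ X₁`
    have hO : IsOpen {P : Motives.ComplexPoints X | P.pt ∉ Z₁} :=
      Motives.AlgPoints.isOpen_setOf_pt_mem (X := X) (L := ℂ) ⟨Z₁ᶜ, hZ₁.isOpen_compl⟩
    set S : Set ↥{P : Motives.ComplexPoints X | P.pt ∉ Z₁} := {Q | Q.1.pt ∈ Z} with hSdef
    have hS : IsClosed S := by
      have h1 : IsClosed {P : Motives.ComplexPoints X | P.pt ∈ Z} :=
        ⟨Motives.AlgPoints.isOpen_setOf_pt_mem (X := X) (L := ℂ) ⟨Zᶜ, hZ.isOpen_compl⟩⟩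
      exact h1.preimage continuous_subtype_val
    -- local flatness of `S` in `X₁`
    have hflat : ∀ x ∈ S, ∃ (F : Type) (_ : NormedAddCommGroup F) (_ : NormedSpace ℝ F)
        (_ : FiniteDimensional ℝ F) (K : Type) (_ : NormedAddCommGroup K) (_ : NormedSpace ℝ K)
        (e : OpenPartialHomeomorph ↥{P : Motives.ComplexPoints X | P.pt ∉ Z₁} (F × K)),
        2 * c ≤ Module.finrank ℝ F ∧ x ∈ e.source ∧ ∀ z ∈ e.source, z ∈ S ↔ (e z).1 = 0 := by
      intro x hx
      obtain ⟨c', K, e, hcc', hxe, he⟩ := hstr x.1 hx x.2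
      let s : Opens (Motives.ComplexPoints X) := ⟨{P | P.pt ∉ Z₁}, hO⟩
      let e' : OpenPartialHomeomorph ↥{P : Motives.ComplexPoints X | P.pt ∉ Z₁} ((Fin c' → ℂ) × ↥K) :=
        e.subtypeRestr (s := s) ⟨x⟩
      refine ⟨Fin c' → ℂ, inferInstance, inferInstance, inferInstance, ↥K, inferInstance,
        inferInstance, e', ?_, ?_, fun z hz ↦ ?_⟩
      · -- `dim_ℝ ℂ^{c'} = 2 c'` (the tree's `Geometry.GeometricMeasureTheory.finrank_real_pi_complex`,
        -- re-derived rather than imported from the measure-theory files)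
        have hfr : Module.finrank ℝ (Fin c' → ℂ) = 2 * c' := by
          rw [Module.finrank_pi_fintype, Finset.sum_const, Finset.card_univ, Fintype.card_fin,
            Complex.finrank_real_complex, smul_eq_mul, mul_comm]
        rw [hfr]
        omega
      · rw [OpenPartialHomeomorph.subtypeRestr_source]
        exact hxe
      · rw [OpenPartialHomeomorph.subtypeRestr_source] at hz
        exact he z.1 hz
    have hsurj := (surjective_injective_map_compl_of_locallyFlat R M hS (2 * c) hflat).1 i hi
    -- compose `Hᵢ(Sᶜ) → Hᵢ((X ∖ Z)(ℂ)) → Hᵢ(X(ℂ))` = `Hᵢ(Sᶜ) ↠ Hᵢ(X₁) ↠ Hᵢ(X(ℂ))`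
    let g : C(↥Sᶜ, ↥{P : Motives.ComplexPoints X | P.pt ∉ Z}) :=
      ⟨fun Q ↦ ⟨Q.1.1, Q.2⟩, by fun_prop⟩
    have hcomp : (subsetIncl {P : Motives.ComplexPoints X | P.pt ∉ Z}).comp g =
        (subsetIncl {P : Motives.ComplexPoints X | P.pt ∉ Z₁}).comp (subsetIncl Sᶜ) :=
      ContinuousMap.ext fun _ ↦ rfl
    intro y
    obtain ⟨y₁, rfl⟩ := ih₁ y
    obtain ⟨y₂, rfl⟩ := hsurj y₁
    refine ⟨singularHomology.map R M g i y₂, ?_⟩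
    rw [← ModuleCat.comp_apply, ← singularHomology.map_comp, hcomp, singularHomology.map_comp,
      ModuleCat.comp_apply]

/-! ### Cohomological semipurity and the vanishing of `Nᶜ Hⁱ` -/

/-- **The restriction `Hⁱ(X(ℂ); ℂ) → Hⁱ((X ∖ Z)(ℂ); ℂ)` is one-to-one for `i < 2 codim Z`**
(Voisin I, Lemma 11.13 along Thm. 11.11; Grothendieck 1969 §1), `X` smooth projective over `ℂ`,
`Z` Zariski-closed with every point of codimension `≥ c`: dual to
`surjective_map_complexPointsCompl_of_le_coheight` under the Kronecker pairing over `ℂ`.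
[cite: VoisinHodgeI2002, §11.1.2 Lemma 11.13 and §11.1.1 Thm. 11.11] [cite: GrothendieckTopology1969, §1] -/
theorem injective_restrictCompl_of_le_coheight (hX : Motives.IsSmoothProjective n X)
    {Z : Set X.left} (hZ : IsClosed Z) {c : ℕ} (hcZ : ∀ z ∈ Z, (c : ℕ∞) ≤ Order.coheight z)
    {i : ℕ} (hi : i < 2 * c) : Function.Injective (complexBetti.restrictCompl X Z i) :=
  injective_cohomologyMap_of_surjective_homologyMap ℂ
    (subsetIncl {P : Motives.ComplexPoints X | P.pt ∉ Z}) i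
    (surjective_map_complexPointsCompl_of_le_coheight ℂ ℂ hX hZ hcZ hi)

/-- **Semipurity of the coniveau filtration: `Nᶜ Hⁱ(X(ℂ); ℂ) = 0` for `i < 2c`** (Grothendieck
1969, §1; Voisin I §11.1.2), for `X` smooth projective over `ℂ` and the tree's
`supportedClasses X i c` (`HodgeTheory/AlgebraicClasses`): every summand
`ker (Hⁱ(X(ℂ); ℂ) → Hⁱ((X ∖ Z)(ℂ); ℂ))`, `Z` Zariski-closed of codimension `≥ c`, vanishes by
`injective_restrictCompl_of_le_coheight`. [cite: GrothendieckTopology1969, §1]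
[cite: VoisinHodgeI2002, §11.1.2 Lemma 11.13 and §11.1.1 Thm. 11.11] -/
theorem supportedClasses_eq_bot_of_lt (hX : Motives.IsSmoothProjective n X) {i c : ℕ}
    (hi : i < 2 * c) : supportedClasses X i c = ⊥ := by
  refine le_bot_iff.1 (iSup_le fun Z ↦ iSup_le fun hZ ↦ iSup_le fun hcZ ↦ ?_)
  rw [LinearMap.ker_eq_bot.2 (injective_restrictCompl_of_le_coheight hX hZ hcZ hi)]

end HodgeTheory

end Literature.AlgebraicGeometry.HodgeTheory

end
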